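/-
Copyright (c) 2026. All rights reserved.
Released under Apache 2.0 license as described in the file LICENSE.
Authors: abc-iut cell, wave-3 prover seat abc-iut-L6-d4 (L3 ROW UnivCoverSimplyConnected).
-/
import Literature.AnabelianGeometry.SemiGraphs.UniversalCoveringConnected
import Literature.AnabelianGeometry.SemiGraphs.UniversalCoveringSimplyConnected
import HarnessLib

/-!
# The universal graph-covering of a semi-graph is a tree ([SemiAnbd] §1 p. 15)

Mochizuki, *Semi-graphs of anabelioids*, Publ. RIMS **42** (2006), §1 p. 15 ("universal
graph-coverings" `𝔾̃ → 𝔾`) and Prop. 3.6 p. 38.  Assembly of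

* abc-iut-L3-t9's `SemiGraph.univCover_isConnected` (`UniversalCoveringConnected.lean`, p407685:
  every node of the barycentric subdivision of `𝔾̃ = G.univCover c₀` is reachable from the base node), and
* `SemiGraph.univCover_subdivision_isAcyclic` (`UniversalCoveringSimplyConnected.lean`: the
  subdivision has no cycles — reduced-length grading, Serre *Trees* I §3 / Stallings §2),

into the statement consumers use (abc-iut-L3-t6 / t11 / d5: local triviality of `𝒢_∞ → 𝒢`,
`π₁` of the universal covering object, [SemiAnbd] Prop. 3.6):

* `SemiGraph.univCover_isTree (G) (c₀) : (G.univCover c₀).IsTree` — for EVERY semi-graph and every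
  base component, in the sense of abc-iut-L3-t1's `SemiGraph.IsTree` (the barycentric subdivision
  `SemiGraph.subdivision` is a tree).

Proof-only file (no definitions). Classical graph theory; nothing here bears on [IUTchIII] Cor. 3.12.
-/

set_option autoImplicit false

namespace Literature.AnabelianGeometry.SemiGraphs

namespace SemiGraph

universe u

variable (G : SemiGraph.{u}) (c₀ : G.CatCarrier)

/-- **The universal graph-covering `𝔾̃ → 𝔾` of a semi-graph is a tree** ([SemiAnbd] §1 p. 15:
"universal graph-covering"; the tree property is what makes `𝒢_{∞} → 𝒢` of Prop. 3.6 p. 38 locally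
trivial with simply connected underlying semi-graph): for every semi-graph `G` and every base component
`c₀`, the barycentric subdivision of `G.univCover c₀` is connected (abc-iut-L3-t9,
`univCover_isConnected`) and acyclic (`univCover_subdivision_isAcyclic`).
[cite: MochizukiSemiAnbd2006, §1 p.15] -/
theorem univCover_isTree : (G.univCover c₀).IsTree :=
  ⟨⟨(G.univCover_isConnected c₀).connected, G.univCover_subdivision_isAcyclic c₀⟩⟩

end SemiGraph

end Literature.AnabelianGeometry.SemiGraphs
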